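import Summits.Ventures.DiscreteObjects.PP12.OrderElevenCollineation
import Summits.Ventures.DiscreteObjects.PP12.TwoThreeGroupReduction

/-!
# PP(12), order-11 cell, Case A: a `QdmRows 11 13` array BUILDS a projective plane of order 12 with a homology of order 11 (kernel; the converse)
Framing: lottery ticket; floor = certified bounds/negative ranges.

Cell pub-namedobj (venture DiscreteObjects), target (M), designs gen 16. Converse of `OrderElevenHomology` (homology ⇒ array): from
`d : Fin 13 → Fin 13 → ZMod 11` with `QdmRows 11 13 d` (`OrderElevenCollineation`, FAMILY-B1P §2) we BUILD a Mathlib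
`Configuration.ProjectivePlane` of order 12 with a collineation `shift` of order 11 (a `(c, l)`-homology):
* points `HPt d` = the centre `ctr`, the axis points `ax j` (`X_j`), the free points `fr j x` (`σ^x P_j`, `x ∈ ZMod 11`); lines `HLn d` = the
  axis, the central lines `cen j` (`c X_j`), the free lines `fl i y` (`σ^y L_i`); incidence `fr j x ∈ fl i y ↔ j ≠ i ∧ x = d i j + y`,
  `ax j ∈ fl i y ↔ j = i`, `ax j ∈ cen j' ↔ j = j'`, `fr j x ∈ cen j' ↔ j = j'`, `ctr ∈ cen j`, `ax j ∈ axis`;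
* two distinct lines meet in exactly one point (`exists_meet`, `meet_unique`; for `fl i y`, `fl i' y'`, `i ≠ i'`, this is the row condition:
  `j ↦ d i j − d i' j` is injective on the `11` columns `j ∉ {i, i'}`, hence hits `y' − y` exactly once, `exists_col`); with `|points| = |lines|`
  Mathlib's `HasPoints.hasLines` gives **`homPlane11 : ProjectivePlane (HPt d) (HLn d)`** of order 12 (`order_homPlane11`);
* `shift` (`x ↦ x + 1` on free points and lines) is a collineation with `shift¹¹ = 1`, `shift ≠ 1`;
* hence `noHomologyArray12_of_noOrderEleven : NoOrderElevenOrder12 → NoHomologyArray12` and `exists_plane_of_qdmRows` (HIT route).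
Together with the Case-B converse and `OrderElevenReduction` this makes `NoCollineationOfOrderEleven ↔ NoOrderElevenOrder12`. Nothing here asserts
`NoHomologyArray12`. No `sorry`, no new axioms.
-/

namespace Summit.Ventures.DiscreteObjects.PP12

open Configuration Finset

namespace HomLift11

/-- points of the plane built from a Case-A array -/
inductive HPt (d : Fin 13 → Fin 13 → ZMod 11) : Type
  | ctr
  | ax (j : Fin 13)
  | fr (j : Fin 13) (x : ZMod 11)
  deriving DecidableEq

/-- lines of the plane built from a Case-A array -/
inductive HLn (d : Fin 13 → Fin 13 → ZMod 11) : Type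
  | axis
  | cen (j : Fin 13)
  | fl (i : Fin 13) (y : ZMod 11)
  deriving DecidableEq

variable {d : Fin 13 → Fin 13 → ZMod 11}

/-- incidence -/
def HPt.Inc : HPt d → HLn d → Prop
  | .ctr, .axis => False
  | .ctr, .cen _ => True
  | .ctr, .fl _ _ => False
  | .ax _, .axis => True
  | .ax j, .cen j' => j = j'
  | .ax j, .fl i _ => j = i
  | .fr _ _, .axis => False
  | .fr j _, .cen j' => j = j'
  | .fr j x, .fl i y => j ≠ i ∧ x = d i j + y

/-- incidence as membership -/
instance : Membership (HPt d) (HLn d) := ⟨fun m p => HPt.Inc p m⟩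

/-- `ctr ∉ axis` -/
@[simp] theorem ctr_mem_axis : (HPt.ctr : HPt d) ∈ (HLn.axis : HLn d) ↔ False := Iff.rfl
/-- `ctr ∈ cen j` -/
@[simp] theorem ctr_mem_cen {j : Fin 13} : (HPt.ctr : HPt d) ∈ (HLn.cen j : HLn d) ↔ True := Iff.rfl
/-- `ctr ∉ fl i y` -/
@[simp] theorem ctr_mem_fl {i : Fin 13} {y : ZMod 11} : (HPt.ctr : HPt d) ∈ (HLn.fl i y : HLn d) ↔ False := Iff.rfl
/-- `ax j ∈ axis` -/
@[simp] theorem ax_mem_axis {j : Fin 13} : (HPt.ax j : HPt d) ∈ (HLn.axis : HLn d) ↔ True := Iff.rfl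
/-- `ax j ∈ cen j' ↔ j = j'` -/
@[simp] theorem ax_mem_cen {j j' : Fin 13} : (HPt.ax j : HPt d) ∈ (HLn.cen j' : HLn d) ↔ j = j' := Iff.rfl
/-- `ax j ∈ fl i y ↔ j = i` -/
@[simp] theorem ax_mem_fl {j i : Fin 13} {y : ZMod 11} : (HPt.ax j : HPt d) ∈ (HLn.fl i y : HLn d) ↔ j = i := Iff.rfl
/-- `fr j x ∉ axis` -/
@[simp] theorem fr_mem_axis {j : Fin 13} {x : ZMod 11} : (HPt.fr j x : HPt d) ∈ (HLn.axis : HLn d) ↔ False := Iff.rfl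
/-- `fr j x ∈ cen j' ↔ j = j'` -/
@[simp] theorem fr_mem_cen {j j' : Fin 13} {x : ZMod 11} : (HPt.fr j x : HPt d) ∈ (HLn.cen j' : HLn d) ↔ j = j' := Iff.rfl
/-- `fr j x ∈ fl i y ↔ j ≠ i ∧ x = d i j + y` -/
@[simp] theorem fr_mem_fl {j : Fin 13} {x : ZMod 11} {i : Fin 13} {y : ZMod 11} :
    (HPt.fr j x : HPt d) ∈ (HLn.fl i y : HLn d) ↔ j ≠ i ∧ x = d i j + y := Iff.rfl

/-! ### The row condition gives the free meets -/

/-- **the row condition, counted**: for `i ≠ i'` every residue `v` is `d i j − d i' j` for exactly one column `j ∉ {i, i'}` -/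
theorem exists_col (hd : QdmRows 11 13 d) {i i' : Fin 13} (hii' : i ≠ i') (v : ZMod 11) :
    ∃ j : Fin 13, j ≠ i ∧ j ≠ i' ∧ d i j - d i' j = v := by
  set J := (univ.erase i).erase i' with hJ
  have hcard : J.card = 11 := by
    rw [hJ, card_erase_of_mem (by rw [mem_erase]; exact ⟨Ne.symm hii', mem_univ _⟩), card_erase_of_mem (mem_univ _), card_univ,
      Fintype.card_fin]
  have hinj : Set.InjOn (fun j => d i j - d i' j) J := by
    intro j hj j' hj' h
    by_contra hne
    have hj2 := mem_erase.1 hj; have hj1 := mem_erase.1 hj2.2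
    have hj'2 := mem_erase.1 hj'; have hj'1 := mem_erase.1 hj'2.2
    exact hd i i' hii' j j' hne hj1.1 hj2.1 hj'1.1 hj'2.1 h
  have himg : (J.image fun j => d i j - d i' j) = univ := by
    apply eq_univ_of_card
    rw [card_image_of_injOn hinj, hcard, ZMod.card]
  have hv : v ∈ J.image fun j => d i j - d i' j := by rw [himg]; exact mem_univ v
  obtain ⟨j, hj, hjv⟩ := mem_image.mp hv
  have hj2 := mem_erase.1 hj; have hj1 := mem_erase.1 hj2.2
  exact ⟨j, hj1.1, hj2.1, hjv⟩

/-- uniqueness of the column -/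
theorem col_unique (hd : QdmRows 11 13 d) {i i' : Fin 13} (hii' : i ≠ i') {j j' : Fin 13} (hj : j ≠ i) (hj' : j ≠ i') (hk : j' ≠ i)
    (hk' : j' ≠ i') (h : d i j - d i' j = d i j' - d i' j') : j = j' := by
  by_contra hne
  exact hd i i' hii' j j' hne hj hj' hk hk' h

/-! ### Two distinct lines meet in exactly one point -/

/-- **existence of the meet** -/
theorem exists_meet (hd : QdmRows 11 13 d) (l₁ l₂ : HLn d) (hne : l₁ ≠ l₂) : ∃ p : HPt d, p ∈ l₁ ∧ p ∈ l₂ := by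
  rcases l₁ with _ | j | ⟨i, y⟩ <;> rcases l₂ with _ | j' | ⟨i', y'⟩
  · exact absurd rfl hne
  · exact ⟨HPt.ax j', by simp, by simp⟩
  · exact ⟨HPt.ax i', by simp, by simp⟩
  · exact ⟨HPt.ax j, by simp, by simp⟩
  · exact ⟨HPt.ctr, by simp, by simp⟩
  · by_cases hji : j = i'
    · exact ⟨HPt.ax j, by simp, by simp [hji]⟩
    · exact ⟨HPt.fr j (d i' j + y'), by simp, by simp [hji]⟩
  · exact ⟨HPt.ax i, by simp, by simp⟩
  · by_cases hji : j' = i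
    · exact ⟨HPt.ax j', by simp [hji], by simp⟩
    · exact ⟨HPt.fr j' (d i j' + y), by simp [hji], by simp⟩
  · by_cases hii' : i = i'
    · subst hii'; exact ⟨HPt.ax i, by simp, by simp⟩
    · obtain ⟨j, hj, hj', hv⟩ := exists_col hd hii' (y' - y)
      refine ⟨HPt.fr j (d i j + y), by simp [hj], ?_⟩
      rw [fr_mem_fl]; refine ⟨hj', ?_⟩
      linear_combination hv

/-- **uniqueness of the meet** -/
theorem meet_unique (hd : QdmRows 11 13 d) {l₁ l₂ : HLn d} (hne : l₁ ≠ l₂) {p₁ p₂ : HPt d} (h1 : p₁ ∈ l₁) (h2 : p₂ ∈ l₁) (h3 : p₁ ∈ l₂)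
    (h4 : p₂ ∈ l₂) : p₁ = p₂ := by
  rcases l₁ with _ | j | ⟨i, y⟩ <;> rcases l₂ with _ | j' | ⟨i', y'⟩
  · exact absurd rfl hne
  · rcases p₁ with _ | a | ⟨a, xa⟩ <;> rcases p₂ with _ | b | ⟨b, xb⟩ <;>
      simp only [ctr_mem_axis, ax_mem_axis, ax_mem_cen, fr_mem_axis] at h1 h2 h3 h4
    subst h3; subst h4; rfl
  · rcases p₁ with _ | a | ⟨a, xa⟩ <;> rcases p₂ with _ | b | ⟨b, xb⟩ <;>
      simp only [ctr_mem_axis, ax_mem_axis, ax_mem_fl, fr_mem_axis] at h1 h2 h3 h4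
    subst h3; subst h4; rfl
  · rcases p₁ with _ | a | ⟨a, xa⟩ <;> rcases p₂ with _ | b | ⟨b, xb⟩ <;>
      simp only [ctr_mem_axis, ax_mem_axis, ax_mem_cen, fr_mem_axis] at h1 h2 h3 h4
    subst h1; subst h2; rfl
  · have hjj' : j ≠ j' := fun e => hne (by rw [e])
    rcases p₁ with _ | a | ⟨a, xa⟩ <;> rcases p₂ with _ | b | ⟨b, xb⟩ <;>
      simp only [ctr_mem_cen, ax_mem_cen, fr_mem_cen] at h1 h2 h3 h4
    all_goals first | rfl | exact absurd (h1.symm.trans h3) hjj' | exact absurd (h2.symm.trans h4) hjj'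
  · -- cen j ∩ fl i' y'
    rcases p₁ with _ | a | ⟨a, xa⟩ <;> rcases p₂ with _ | b | ⟨b, xb⟩ <;>
      simp only [ctr_mem_cen, ctr_mem_fl, ax_mem_cen, ax_mem_fl, fr_mem_cen, fr_mem_fl] at h1 h2 h3 h4
    · subst h3; subst h4; rfl
    · subst h1; subst h2; exact absurd h3 h4.1
    · subst h1; subst h2; exact absurd h4 h3.1
    · subst h1; subst h2; rw [h3.2, h4.2]
  · rcases p₁ with _ | a | ⟨a, xa⟩ <;> rcases p₂ with _ | b | ⟨b, xb⟩ <;>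
      simp only [ctr_mem_axis, ax_mem_axis, ax_mem_fl, fr_mem_axis] at h1 h2 h3 h4
    subst h1; subst h2; rfl
  · -- fl i y ∩ cen j'
    rcases p₁ with _ | a | ⟨a, xa⟩ <;> rcases p₂ with _ | b | ⟨b, xb⟩ <;>
      simp only [ctr_mem_fl, ax_mem_cen, ax_mem_fl, fr_mem_cen, fr_mem_fl] at h1 h2 h3 h4
    · subst h1; subst h2; rfl
    · subst h3; subst h4; exact absurd h1 h2.1
    · subst h3; subst h4; exact absurd h2 h1.1
    · subst h3; subst h4; rw [h1.2, h2.2]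
  · -- fl i y ∩ fl i' y'
    rcases p₁ with _ | a | ⟨a, xa⟩ <;> rcases p₂ with _ | b | ⟨b, xb⟩ <;>
      simp only [ctr_mem_fl, ax_mem_fl, fr_mem_fl] at h1 h2 h3 h4
    · subst h1; subst h2; rfl
    · subst h1; subst h3
      have hyy' : y = y' := add_left_cancel (h2.2.symm.trans h4.2)
      subst hyy'; exact absurd rfl hne
    · subst h2; subst h4
      have hyy' : y = y' := add_left_cancel (h1.2.symm.trans h3.2)
      subst hyy'; exact absurd rfl hne
    · by_cases hii' : i = i'
      · subst hii'
        have hyy' : y = y' := by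
          have := h1.2.symm.trans h3.2
          exact add_left_cancel this
        subst hyy'; exact absurd rfl hne
      · have hv1 : d i a - d i' a = y' - y := by linear_combination h3.2 - h1.2
        have hv2 : d i b - d i' b = y' - y := by linear_combination h4.2 - h2.2
        have hab : a = b := col_unique hd hii' h1.1 h3.1 h2.1 h4.1 (hv1.trans hv2.symm)
        subst hab; rw [h1.2, h2.2]

/-! ### Finiteness and the plane -/

/-- points as a sum type -/
def HPt.equivSum : HPt d ≃ Unit ⊕ Fin 13 ⊕ (Fin 13 × ZMod 11) where
  toFun p := match p with | .ctr => Sum.inl () | .ax j => Sum.inr (Sum.inl j) | .fr j x => Sum.inr (Sum.inr (j, x))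
  invFun q := match q with | Sum.inl _ => .ctr | Sum.inr (Sum.inl j) => .ax j | Sum.inr (Sum.inr (j, x)) => .fr j x
  left_inv := by rintro (_ | j | ⟨j, x⟩) <;> rfl
  right_inv := by rintro (⟨⟩ | j | ⟨j, x⟩) <;> rfl

/-- lines as a sum type -/
def HLn.equivSum : HLn d ≃ Unit ⊕ Fin 13 ⊕ (Fin 13 × ZMod 11) where
  toFun m := match m with | .axis => Sum.inl () | .cen j => Sum.inr (Sum.inl j) | .fl i y => Sum.inr (Sum.inr (i, y))
  invFun q := match q with | Sum.inl _ => .axis | Sum.inr (Sum.inl j) => .cen j | Sum.inr (Sum.inr (i, y)) => .fl i y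
  left_inv := by rintro (_ | j | ⟨i, y⟩) <;> rfl
  right_inv := by rintro (⟨⟩ | j | ⟨i, y⟩) <;> rfl

/-- finitely many points -/
instance : Fintype (HPt d) := Fintype.ofEquiv _ HPt.equivSum.symm
/-- finitely many lines -/
instance : Fintype (HLn d) := Fintype.ofEquiv _ HLn.equivSum.symm

/-- as many points as lines -/
theorem card_HPt_eq_card_HLn : Fintype.card (HPt d) = Fintype.card (HLn d) := by
  rw [Fintype.card_congr (HPt.equivSum (d := d)), Fintype.card_congr (HLn.equivSum (d := d))]

/-- any two lines meet (and the structure is nondegenerate) -/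
@[reducible] noncomputable def homHasPoints (hd : QdmRows 11 13 d) : HasPoints (HPt d) (HLn d) where
  exists_point := by
    rintro (_ | j | ⟨i, y⟩)
    · exact ⟨HPt.ctr, by simp⟩
    · exact ⟨HPt.ax (j + 1), by simp⟩
    · exact ⟨HPt.ctr, by simp⟩
  exists_line := by
    rintro (_ | j | ⟨j, x⟩)
    · exact ⟨HLn.axis, by simp⟩
    · exact ⟨HLn.cen (j + 1), by simp⟩
    · exact ⟨HLn.axis, by simp⟩
  eq_or_eq := fun {p₁ p₂ l₁ l₂} h1 h2 h3 h4 => by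
    by_cases hl : l₁ = l₂
    · exact Or.inr hl
    · exact Or.inl (meet_unique hd hl h1 h2 h3 h4)
  mkPoint := fun {l₁ l₂} h => Classical.choose (exists_meet hd l₁ l₂ h)
  mkPoint_ax := fun {l₁ l₂} h => Classical.choose_spec (exists_meet hd l₁ l₂ h)

/-- **The plane built from a Case-A array.** -/
@[reducible] noncomputable def homPlane11 (hd : QdmRows 11 13 d) : ProjectivePlane (HPt d) (HLn d) :=
  let hP : HasPoints (HPt d) (HLn d) := homHasPoints hd
  let hL : HasLines (HPt d) (HLn d) := @HasPoints.hasLines _ _ _ hP _ _ card_HPt_eq_card_HLn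
  { hP, hL with
    exists_config := ⟨HPt.ax 2, HPt.ctr, HPt.fr 0 0, HLn.axis, HLn.cen 0, HLn.cen 1, by simp, by simp, by simp, by simp, by simp, by simp,
      by simp, by simp⟩ }

/-- the axis carries exactly the 13 points `ax j` -/
theorem natCard_mem_axis : Nat.card {p : HPt d // p ∈ (HLn.axis : HLn d)} = 13 := by
  let e : {p : HPt d // p ∈ (HLn.axis : HLn d)} ≃ Fin 13 :=
    { toFun := fun p => match p with | ⟨.ax j, _⟩ => j | ⟨.ctr, h⟩ => (h : False).elim | ⟨.fr _ _, h⟩ => (h : False).elim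
      invFun := fun j => ⟨.ax j, by simp⟩
      left_inv := by rintro ⟨_ | j | ⟨j, x⟩, h⟩ <;> first | rfl | exact (h : False).elim
      right_inv := fun j => rfl }
  rw [Nat.card_congr e, Nat.card_eq_fintype_card, Fintype.card_fin]

/-- **The plane has order 12.** -/
theorem order_homPlane11 (hd : QdmRows 11 13 d) : @ProjectivePlane.order (HPt d) (HLn d) _ (homPlane11 hd) = 12 := by
  letI := homPlane11 hd
  have h : Nat.card {p : HPt d // p ∈ (HLn.axis : HLn d)} = ProjectivePlane.order (HPt d) (HLn d) + 1 :=
    ProjectivePlane.pointCount_eq (HPt d) (HLn.axis : HLn d)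
  rw [natCard_mem_axis] at h
  omega

/-! ### The homology of order 11 -/

/-- shift on points -/
def shiftPt : HPt d → HPt d
  | .ctr => .ctr | .ax j => .ax j | .fr j x => .fr j (x + 1)
/-- inverse shift on points -/
def unshiftPt : HPt d → HPt d
  | .ctr => .ctr | .ax j => .ax j | .fr j x => .fr j (x - 1)
/-- shift on lines -/
def shiftLn : HLn d → HLn d
  | .axis => .axis | .cen j => .cen j | .fl i y => .fl i (y + 1)
/-- inverse shift on lines -/
def unshiftLn : HLn d → HLn d
  | .axis => .axis | .cen j => .cen j | .fl i y => .fl i (y - 1)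

/-- **the shift is a collineation** (a homology with centre `ctr` and axis `axis`) -/
def shift : Collineation (HPt d) (HLn d) where
  onPoints := ⟨shiftPt, unshiftPt, by rintro (_ | j | ⟨j, x⟩) <;> simp [shiftPt, unshiftPt],
    by rintro (_ | j | ⟨j, x⟩) <;> simp [shiftPt, unshiftPt]⟩
  onLines := ⟨shiftLn, unshiftLn, by rintro (_ | j | ⟨i, y⟩) <;> simp [shiftLn, unshiftLn],
    by rintro (_ | j | ⟨i, y⟩) <;> simp [shiftLn, unshiftLn]⟩
  mem_iff := by
    rintro (_ | j | ⟨j, x⟩) (_ | j' | ⟨i, y⟩) <;> simp [shiftPt, shiftLn, ← add_assoc]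

/-- powers of the shift on free points -/
theorem shift_pow_fr (k : ℕ) (j : Fin 13) (x : ZMod 11) :
    ((shift : Collineation (HPt d) (HLn d)).onPoints ^ k) (HPt.fr j x) = HPt.fr j (x + (k : ZMod 11)) := by
  induction k with
  | zero => simp
  | succ k ih =>
    rw [pow_succ', Equiv.Perm.mul_apply, ih]
    show HPt.fr j (x + (k : ZMod 11) + 1) = _
    congr 1; push_cast; ring

/-- `shift¹¹ = 1` -/
theorem shift_pow_eleven : (shift : Collineation (HPt d) (HLn d)).onPoints ^ 11 = 1 := by
  ext p
  rcases p with _ | j | ⟨j, x⟩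
  · rw [Equiv.Perm.pow_apply_eq_self_of_apply_eq_self (rfl : shift.onPoints (HPt.ctr : HPt d) = _)]; rfl
  · rw [Equiv.Perm.pow_apply_eq_self_of_apply_eq_self (rfl : shift.onPoints (HPt.ax j : HPt d) = _)]; rfl
  · rw [shift_pow_fr, ZMod.natCast_self, add_zero]; rfl

/-- `shift ≠ 1` -/
theorem shift_ne_one : (shift : Collineation (HPt d) (HLn d)).onPoints ≠ 1 := by
  intro h
  have h' := congrArg (fun τ : Equiv.Perm (HPt d) => τ (HPt.fr 0 0)) h
  have h'' : (HPt.fr 0 (0 + 1) : HPt d) = HPt.fr 0 0 := h'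
  simp only [HPt.fr.injEq, true_and, zero_add] at h''
  exact absurd h'' (by decide)

end HomLift11

open HomLift11 in
/-- **HIT route / exactness:** a Case-A array gives a projective plane of order 12 with a collineation `σ ≠ 1`, `σ¹¹ = 1`. -/
theorem exists_plane_of_qdmRows (d : Fin 13 → Fin 13 → ZMod 11) (hd : QdmRows 11 13 d) :
    ∃ (P L : Type) (_ : Membership P L) (_ : Fintype P) (_ : Fintype L) (_ : ProjectivePlane P L),
      ProjectivePlane.order P L = 12 ∧ ∃ σ : Collineation P L, σ.onPoints ^ 11 = 1 ∧ σ.onPoints ≠ 1 :=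
  ⟨HPt d, HLn d, inferInstance, inferInstance, inferInstance, homPlane11 hd, order_homPlane11 hd, shift, shift_pow_eleven, shift_ne_one⟩

/-- **The converse reduction, Case A: `NoOrderElevenOrder12 → NoHomologyArray12`.** -/
theorem noHomologyArray12_of_noOrderEleven (h : NoOrderElevenOrder12) : NoHomologyArray12 := by
  intro d hd
  obtain ⟨P, L, i1, i2, i3, i4, h12, σ, hq, hne⟩ := exists_plane_of_qdmRows d hd
  exact hne (h P L h12 σ hq)

end Summit.Ventures.DiscreteObjects.PP12
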